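import Summits.ValiantsHypothesis.ValiantsHypothesis.Theorems.BarrierLeverChowThinRowsStarColumnsPrelims
import Summits.ValiantsHypothesis.ValiantsHypothesis.Theorems.BarrierLeverChowThinRowsSubcubeBasis

/-!
# Route BarrierLever — item `ChowHitsThinRowPartitionMinors` (stmt-ValiantsHypothesis-20195):
# the PAIR LAYER on STAR columns — all thin rows containing `∅` × columns of size `≤ 1`, every height

Helper file (`--supports stmt-ValiantsHypothesis-20195`; cell valiant-natproofs, rung V4, 𝒟-side of
door (c); prover seat val-np-p8 gen 2).  Closes NO item; imports the companion `…ChowThinRowsStarColumnsPrelims`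
(row formulas of the balanced design) and prover g10's `…ChowThinRowsSubcubeBasis` (packaging
`exists_forms_of_card_le`); no route file, no definitions.

**Theorem `chowHits_thinRows_starColumns`.**  For every height `h ≥ 1`, every `r`, all injective
THIN rows `u i` (`|u i| ≤ 2`) one of which is `∅`, and all injective columns of size `≤ 1`
(`w j ∈ {∅} ∪ {{c}}` — the STAR, i.e. the `0`-dimensional down-closed complex), ONE explicit product
of `h + h` affine forms with coefficients in `ℤ` makes the partition minor nonsingular.  This is the
family on which every labelling theorem of the cell is silent (`{∅, a, b, ab} × {∅, {1}, {2}, {3}}` =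
the «killer» of HOME/val-np-p8/MEMO-pairlayer-g0 §3 (X), which needs two generic variables, and the
Leibniz quadruples of planner g15's MEMO-normalforms §7.2): no union labelling `L(a) ∪ L(b) ∈ 𝒟`
exists there because the star has no faces of size `2`.

**The witness (BALANCED HADAMARD design).**  Forms indexed by `𝒦 = {∅} ∪ {w j : w j ≠ ∅}`:
`φ_V = 1 + Σ_a κ_a(V) x_a + Σ_{c ∈ V} y_c` with `κ_a(w j) = [a ∈ u (π j)]` for the nonempty columns
(`π` = the transposition pairing the empty column, if any, with the empty row) and the BALANCING
`κ_a(∅) = -#{j : w j ≠ ∅, a ∈ u (π j)}`, so that `Σ_{V ∈ 𝒦} κ_a(V) = 0` for every `a`.  Then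
(`coeff_single_*_bal`, `coeff_pair_*_bal`): row `∅` is the all-ones vector, row `{a}` is
`-(indicator of the columns j with a ∈ u (π j))`, and row `{a,b}` is `-Q_{ab} · 𝟙 + 2 · e_{π⁻¹ i}`
(the HADAMARD term `2 κ_a κ_b`), whence `M v = 0 ⇒ v = 0` by peeling `∅`-row, pair rows, singleton
rows (`mulVec_injective_iff_isUnit`).

WHAT THIS IS NOT: rows without the empty row, and columns of size `≥ 2`, are not treated here; items
20195 / 20172 / 19717 are NOT proved; nothing on crux stmt-ValiantsHypothesis-14610 or `VP ≠ VNP`.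
-/

set_option linter.dupNamespace false

namespace Summit.ValiantsHypothesis.ValiantsHypothesis.Theorems.BarrierLever.ChowSubcube

open Finset MvPolynomial
open Summit.ValiantsHypothesis.ValiantsHypothesis.Theorems.BarrierLever.ChowFactor
  (coeff_partitionExpo_mul_affine totalDegree_affine_le)
open Summit.ValiantsHypothesis.ValiantsHypothesis.Theorems.BarrierLever.ProductStateSums
  (castAdd_ne_natAdd partitionExpo_apply_castAdd partitionExpo_apply_natAdd)
open Summit.ValiantsHypothesis.ValiantsHypothesis.Theorems.BarrierLever.CorankRepair (partitionExpo_eq_iff)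

variable {h : ℕ}

/-! ## 3. The theorem: thin rows containing `∅` × star columns, every height -/

/-- **Thin-row CPM on STAR columns, every height `h ≥ 1`** (item `ChowHitsThinRowPartitionMinors`,
stmt-ValiantsHypothesis-20195, on the layouts: rows of size `≤ 2` including the empty row, columns of
size `≤ 1`): ONE explicit product of `h + h` affine forms with integer coefficients — the balanced
Hadamard design of the indicator forms over `{∅} ∪ {w j ≠ ∅}` — makes the partition minor nonsingular.
Covers the «killer» `{∅, a, b, ab} × {∅, {1}, {2}, {3}}` and every Leibniz quadruple on a star. -/
theorem chowHits_thinRows_starColumns (h : ℕ) (hh : 1 ≤ h) (r : ℕ) (u w : Fin r → Finset (Fin h))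
    (hu : Function.Injective u) (hw : Function.Injective w)
    (hu2 : ∀ i, (u i).card ≤ 2) (h0 : ∃ i₀, u i₀ = ∅) (hw1 : ∀ j, (w j).card ≤ 1) :
    ∃ ℓ : Fin (h + h) → MvPolynomial (Fin (h + h)) ℂ, (∀ k, (ℓ k).totalDegree ≤ 1) ∧
      (Matrix.of fun i j : Fin r => MvPolynomial.coeff
        (∑ a ∈ u i, Finsupp.single (Fin.castAdd h a) 1 +
          ∑ c ∈ w j, Finsupp.single (Fin.natAdd h c) 1) (∏ k, ℓ k)).det ≠ 0 := by
  classical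
  obtain ⟨i₀, hi₀⟩ := h0
  -- shapes of rows and columns
  have hwcases : ∀ j, w j = ∅ ∨ ∃ c, w j = {c} := by
    intro j
    rcases Nat.lt_or_ge (w j).card 1 with h0' | h1'
    · exact Or.inl (Finset.card_eq_zero.mp (by omega))
    · exact Or.inr (Finset.card_eq_one.mp (le_antisymm (hw1 j) h1'))
  have hucases : ∀ i, u i ≠ ∅ → (∃ a, u i = {a}) ∨ ∃ a b, a ≠ b ∧ u i = {a, b} := by
    intro i hi
    have hpos : 0 < (u i).card := Finset.card_pos.mpr (Finset.nonempty_iff_ne_empty.mpr hi)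
    rcases Nat.lt_or_ge (u i).card 2 with hlt | hge
    · exact Or.inl (Finset.card_eq_one.mp (by omega))
    · exact Or.inr (Finset.card_eq_two.mp (le_antisymm (hu2 i) hge))
  have hune : ∀ i, i ≠ i₀ → u i ≠ ∅ := fun i hi e => hi (hu (e.trans hi₀.symm))
  -- the pairing `π`: the empty column (if any) is sent to the empty row
  let j₁ : Fin r := if hW : ∃ j, w j = ∅ then hW.choose else i₀
  let π : Equiv.Perm (Fin r) := Equiv.swap j₁ i₀
  have hπj : ∀ j, w j = ∅ → π j = i₀ := by
    intro j hj
    have hW : ∃ j, w j = ∅ := ⟨j, hj⟩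
    have hj₁ : j₁ = j := by
      have e : w hW.choose = ∅ := hW.choose_spec
      simp only [j₁, dif_pos hW]
      exact hw (e.trans hj.symm)
    rw [← hj₁]
    exact Equiv.swap_apply_left _ _
  have hwne : ∀ i, u i ≠ ∅ → w (π.symm i) ≠ ∅ := by
    intro i hi hcontra
    have e := hπj (π.symm i) hcontra
    rw [Equiv.apply_symm_apply] at e
    exact hi (by rw [e]; exact hi₀)
  -- the index family of the forms: `∅` and the nonempty columns
  set J : Finset (Fin r) := Finset.univ.filter fun j => w j ≠ ∅ with hJ
  set PT : Finset (Finset (Fin h)) := insert ∅ (J.image w) with hPT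
  have hJmem : ∀ j, j ∈ J ↔ w j ≠ ∅ := fun j => by simp [hJ]
  have h1 : ∀ V ∈ PT, V.card ≤ 1 := by
    intro V hV
    rcases Finset.mem_insert.mp hV with e | hV'
    · rw [e, Finset.card_empty]; exact Nat.zero_le _
    · obtain ⟨j, -, rfl⟩ := Finset.mem_image.mp hV'
      exact hw1 j
  have hwPT : ∀ j, w j ∈ PT := by
    intro j
    by_cases hj : w j = ∅
    · rw [hj]; exact Finset.mem_insert_self _ _
    · exact Finset.mem_insert_of_mem (Finset.mem_image.mpr ⟨j, (hJmem j).mpr hj, rfl⟩)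
  have h0PT : (∅ : Finset (Fin h)) ∉ J.image w := by
    intro hm
    obtain ⟨j, hj, e⟩ := Finset.mem_image.mp hm
    exact (hJmem j).mp hj e
  have hcardPT : PT.card ≤ h + h := by
    have hsub : J.image w ⊆ (Finset.univ : Finset (Fin h)).image fun c => ({c} : Finset (Fin h)) := by
      intro V hV
      obtain ⟨j, hj, rfl⟩ := Finset.mem_image.mp hV
      rcases hwcases j with e | ⟨c, hc⟩
      · exact absurd e ((hJmem j).mp hj)
      · exact Finset.mem_image.mpr ⟨c, Finset.mem_univ _, hc.symm⟩
    have h2 : (J.image w).card ≤ h :=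
      (Finset.card_le_card hsub).trans (Finset.card_image_le.trans (by rw [Finset.card_univ, Fintype.card_fin]))
    rw [hPT, Finset.card_insert_of_notMem h0PT]
    omega
  -- the balanced Hadamard design
  let D : Fin h → ℂ := fun a => ((J.filter fun j => a ∈ u (π j)).card : ℂ)
  let κ : Fin h → Finset (Fin h) → ℂ := fun a V =>
    if V = ∅ then -D a else ((Finset.univ.filter fun j => w j = V ∧ a ∈ u (π j)).card : ℂ)
  have hκW : ∀ j a, w j ≠ ∅ → κ a (w j) = if a ∈ u (π j) then 1 else 0 := by
    intro j a hj
    simp only [κ, if_neg hj]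
    by_cases ha : a ∈ u (π j)
    · rw [if_pos ha]
      have e : (Finset.univ.filter fun j' => w j' = w j ∧ a ∈ u (π j')) = {j} := by
        ext j'
        simp only [Finset.mem_filter, Finset.mem_univ, true_and, Finset.mem_singleton]
        exact ⟨fun hh => hw hh.1, fun e => by subst e; exact ⟨rfl, ha⟩⟩
      rw [e, Finset.card_singleton, Nat.cast_one]
    · rw [if_neg ha]
      have e : (Finset.univ.filter fun j' => w j' = w j ∧ a ∈ u (π j')) = ∅ :=
        Finset.filter_eq_empty_iff.mpr fun j' _ hh => ha (by rw [← hw hh.1]; exact hh.2)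
      rw [e, Finset.card_empty, Nat.cast_zero]
  have hA : ∀ a, ∑ V ∈ PT, κ a V = 0 := by
    intro a
    rw [hPT, Finset.sum_insert h0PT, Finset.sum_image fun j _ j' _ e => hw e]
    have e1 : κ a ∅ = -D a := by simp only [κ, if_pos rfl]
    have e2 : ∑ j ∈ J, κ a (w j) = D a := by
      rw [Finset.sum_congr rfl fun j hj => hκW j a ((hJmem j).mp hj), Finset.sum_boole]
    rw [e1, e2, neg_add_cancel]
  have hκκ : ∀ j a b, a ≠ b → w j ≠ ∅ →
      κ a (w j) * κ b (w j) = if u (π j) = {a, b} then 1 else 0 := by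
    intro j a b hab hj
    rw [hκW j a hj, hκW j b hj]
    by_cases hab' : u (π j) = {a, b}
    · rw [if_pos hab', if_pos (by rw [hab']; simp), if_pos (by rw [hab']; simp), mul_one]
    · rw [if_neg hab']
      by_cases ha : a ∈ u (π j)
      · by_cases hb : b ∈ u (π j)
        · exfalso
          refine hab' (Finset.eq_of_subset_of_card_le (fun x hx => ?_) ?_).symm
          · rcases Finset.mem_insert.mp hx with e | e
            · rw [e]; exact ha
            · rw [Finset.mem_singleton.mp e]; exact hb
          · rw [Finset.card_pair hab]; exact hu2 _
        · rw [if_neg hb, mul_zero]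
      · rw [if_neg ha, zero_mul]
  -- the forms and their embedding into `Fin (h + h)`
  obtain ⟨ℓ, hℓdeg, hℓprod⟩ := exists_forms_of_card_le PT hcardPT
    (fun V => C 1 + ∑ a, C (κ a V) * X (Fin.castAdd h a) +
      ∑ c, C (if c ∈ V then (1 : ℂ) else 0) * X (Fin.natAdd h c))
    (fun V _ => by
      have e : (C 1 + ∑ a, C (κ a V) * X (Fin.castAdd h a) +
          ∑ c, C (if c ∈ V then (1 : ℂ) else 0) * X (Fin.natAdd h c) : MvPolynomial (Fin (h + h)) ℂ) =
          C 1 + ∑ v : Fin (h + h), C (Fin.append (fun a => κ a V)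
            (fun c => if c ∈ V then (1 : ℂ) else 0) v) * X v := by
        rw [Fin.sum_univ_add]
        simp only [Fin.append_left, Fin.append_right, add_assoc]
      rw [e]
      exact totalDegree_affine_le _ _)
  refine ⟨ℓ, hℓdeg, ?_⟩
  rw [hℓprod]
  set M : Matrix (Fin r) (Fin r) ℂ := Matrix.of fun i j : Fin r => MvPolynomial.coeff
      (∑ a ∈ u i, Finsupp.single (Fin.castAdd h a) 1 + ∑ c ∈ w j, Finsupp.single (Fin.natAdd h c) 1)
      (∏ V ∈ PT, (C 1 + ∑ a, C (κ a V) * X (Fin.castAdd h a) +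
        ∑ c, C (if c ∈ V then (1 : ℂ) else 0) * X (Fin.natAdd h c))) with hM
  -- Step 1: the entries
  have hrow0 : ∀ j, M i₀ j = 1 := by
    intro j
    rw [hM, Matrix.of_apply, hi₀]
    rcases hwcases j with e | ⟨c, hc⟩
    · rw [e, coeff_empty_empty_prod]
    · rw [hc, coeff_empty_singleton_prod, card_filter_mem_of_card_le_one PT h1, if_pos (hc ▸ hwPT j)]
  have hrow1 : ∀ i a, u i = {a} → ∀ j,
      M i j = -(if w j ≠ ∅ ∧ a ∈ u (π j) then 1 else 0) := by
    intro i a hia j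
    rw [hM, Matrix.of_apply, hia]
    rcases hwcases j with e | ⟨c, hc⟩
    · rw [e, coeff_single_empty_prod_bal κ PT a (hA a), if_neg (fun hh => hh.1 rfl), neg_zero]
    · have hj : w j ≠ ∅ := by rw [hc]; exact Finset.singleton_ne_empty c
      rw [hc, coeff_single_singleton_prod_bal κ PT h1 a c (hc ▸ hwPT j) (hA a), ← hc, hκW j a hj]
      by_cases ha : a ∈ u (π j)
      · rw [if_pos ha, if_pos ⟨hj, ha⟩]
      · rw [if_neg ha, if_neg (fun hh => ha hh.2)]
  have hrow2 : ∀ i a b, a ≠ b → u i = {a, b} → ∀ j,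
      M i j = -(∑ V ∈ PT, κ a V * κ b V) + 2 * (if w j ≠ ∅ ∧ u (π j) = {a, b} then 1 else 0) := by
    intro i a b hab hiab j
    rw [hM, Matrix.of_apply, hiab]
    rcases hwcases j with e | ⟨c, hc⟩
    · rw [e, coeff_pair_empty_prod_bal κ PT hab (hA b), if_neg (fun hh => hh.1 rfl), mul_zero, add_zero]
    · have hj : w j ≠ ∅ := by rw [hc]; exact Finset.singleton_ne_empty c
      rw [hc, coeff_pair_singleton_prod_bal κ PT h1 hab c (hc ▸ hwPT j) (hA a) (hA b), ← hc,
        hκκ j a b hab hj]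
      by_cases hab' : u (π j) = {a, b}
      · rw [if_pos hab', if_pos ⟨hj, hab'⟩]
      · rw [if_neg hab', if_neg (fun hh => hab' hh.2)]
  -- Step 2: `M v = 0 ⇒ v = 0`
  have hker : ∀ v : Fin r → ℂ, M.mulVec v = 0 → v = 0 := by
    intro v hv
    have hvrow : ∀ i, ∑ j, M i j * v j = 0 := fun i => by
      have := congr_fun hv i
      simpa [Matrix.mulVec, dotProduct] using this
    -- the empty row: Σ_j v_j = 0
    have hsum : ∑ j, v j = 0 := by
      have := hvrow i₀
      simpa [hrow0] using this
    -- the indicator sums over the columns paired with a fixed row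
    have hind : ∀ i, u i ≠ ∅ → ∀ j, ((w j ≠ ∅ ∧ u (π j) = u i) ↔ j = π.symm i) := by
      intro i hi j
      constructor
      · intro hh
        rw [Equiv.eq_symm_apply]
        exact hu hh.2
      · intro e
        subst e
        exact ⟨hwne i hi, by rw [Equiv.apply_symm_apply]⟩
    -- pair rows
    have hpair : ∀ i a b, a ≠ b → u i = {a, b} → v (π.symm i) = 0 := by
      intro i a b hab hiab
      have hi : u i ≠ ∅ := by rw [hiab]; exact Finset.insert_ne_empty a {b}
      have hterm : ∀ j, (if w j ≠ ∅ ∧ u (π j) = {a, b} then (1 : ℂ) else 0) * v j =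
          if j = π.symm i then v j else 0 := by
        intro j
        by_cases hj : j = π.symm i
        · rw [if_pos hj, if_pos ((hind i hi j).mpr hj |>.imp_right fun e => e.trans hiab), one_mul]
        · rw [if_neg hj, if_neg (fun hh => hj ((hind i hi j).mp ⟨hh.1, hh.2.trans hiab.symm⟩)), zero_mul]
      have hs : ∑ j, (if w j ≠ ∅ ∧ u (π j) = {a, b} then (1 : ℂ) else 0) * v j = v (π.symm i) := by
        rw [Finset.sum_congr rfl fun j _ => hterm j, Finset.sum_ite_eq' Finset.univ (π.symm i),
          if_pos (Finset.mem_univ _)]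
      have e := hvrow i
      rw [Finset.sum_congr rfl (fun j _ => by rw [hrow2 i a b hab hiab j])] at e
      have key : ∑ j, (-(∑ V ∈ PT, κ a V * κ b V) +
          2 * (if w j ≠ ∅ ∧ u (π j) = {a, b} then (1 : ℂ) else 0)) * v j =
          -(∑ V ∈ PT, κ a V * κ b V) * ∑ j, v j +
            2 * ∑ j, (if w j ≠ ∅ ∧ u (π j) = {a, b} then (1 : ℂ) else 0) * v j := by
        rw [Finset.mul_sum, Finset.mul_sum, ← Finset.sum_add_distrib]
        exact Finset.sum_congr rfl fun j _ => by ring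
      rw [key, hsum, hs, mul_zero, zero_add] at e
      exact (mul_eq_zero.mp e).resolve_left two_ne_zero
    -- singleton rows
    have hsingle : ∀ i a, u i = {a} → v (π.symm i) = 0 := by
      intro i a hia
      have hi : u i ≠ ∅ := by rw [hia]; exact Finset.singleton_ne_empty a
      have e := hvrow i
      rw [Finset.sum_congr rfl (fun j _ => by rw [hrow1 i a hia j, neg_mul]), Finset.sum_neg_distrib,
        neg_eq_zero] at e
      -- reindex the sum through `π`
      have hre : ∑ j, (if w j ≠ ∅ ∧ a ∈ u (π j) then (1 : ℂ) else 0) * v j =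
          ∑ i', (if w (π.symm i') ≠ ∅ ∧ a ∈ u i' then (1 : ℂ) else 0) * v (π.symm i') := by
        rw [← Equiv.sum_comp π.symm]
        simp only [Equiv.apply_symm_apply]
      rw [hre, Finset.sum_eq_single i] at e
      · rw [if_pos ⟨hwne i hi, by rw [hia]; exact Finset.mem_singleton_self a⟩, one_mul] at e
        exact e
      · intro i' _ hi'
        by_cases ha : a ∈ u i'
        · -- `i'` is a pair row containing `a`
          have hne : u i' ≠ ∅ := Finset.ne_empty_of_mem ha
          rcases hucases i' hne with ⟨a', ha'⟩ | ⟨a', b', hab', hab''⟩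
          · exfalso
            apply hi'
            apply hu
            rw [ha', Finset.mem_singleton] at ha
            rw [ha', hia, ha]
          · rw [hpair i' a' b' hab' hab'', mul_zero]
        · rw [if_neg (fun hh => ha hh.2), zero_mul]
      · intro hi'; exact absurd (Finset.mem_univ i) hi'
    -- every coordinate paired with a nonempty row vanishes
    have hval : ∀ i, i ≠ i₀ → v (π.symm i) = 0 := by
      intro i hi
      rcases hucases i (hune i hi) with ⟨a, ha⟩ | ⟨a, b, hab, hab'⟩
      · exact hsingle i a ha
      · exact hpair i a b hab hab'
    -- and the last one by the empty row
    have hlast : v (π.symm i₀) = 0 := by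
      rw [Finset.sum_eq_single (π.symm i₀) (fun j _ hj => ?_) (fun hh => absurd (Finset.mem_univ _) hh)] at hsum
      · exact hsum
      · have e : j = π.symm (π j) := by rw [Equiv.symm_apply_apply]
        rw [e]
        exact hval (π j) (fun hh => hj (by rw [e, hh]))
    funext j
    have e : j = π.symm (π j) := by rw [Equiv.symm_apply_apply]
    rw [e, Pi.zero_apply]
    by_cases hj : π j = i₀
    · rw [hj]; exact hlast
    · exact hval (π j) hj
  -- Step 3: conclude
  have hinj : Function.Injective M.mulVec := by
    intro v₁ v₂ hv
    rw [← sub_eq_zero]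
    exact hker (v₁ - v₂) (by rw [Matrix.mulVec_sub, hv, sub_self])
  have hunit : IsUnit M := Matrix.mulVec_injective_iff_isUnit.mp hinj
  exact ((Matrix.isUnit_iff_isUnit_det M).mp hunit).ne_zero

end Summit.ValiantsHypothesis.ValiantsHypothesis.Theorems.BarrierLever.ChowSubcube
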